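/-
Copyright: b2b-lace cell (CriticalPhenomena). Text-final: enum1-g66 desk draft 1 (477b53103e487451) + header relabel
ONLY (enum1-g75, LEAD WORD W-11, STATUS l.4599), filed by the enum1 seat on the LEAD's booking word following the
referee's scope line on Q-CASEA-SCOPE (STATUS l.4599 (A′)), after `NobleWeightedN1XSpace` (p381831),
`NobleWeightedLettersHn` (p375510) and `NobleWeightedParallelogram` (p375127) landed and were built.  App. C.1 Case a):
the two one-side-trivial class-`0` pieces `R_R(ι,0)`, `R_L(ι,0)` of the weighted `N = 1` diagram at the percolation
letters, onto `H^D_1`, `H_2(0)`, `Σ_w D_{1,1}(w)` and the typed letter `Σ_s Ā'^{ι,0,0}(0,0,s,s)`.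
DIAGONAL CONVENTION (GAPS G-D98; descriptive only).  Class `0` carries NO separate diagonal addend: in class `(0,0)`
the trivial triangle is a single site (`u = w`, resp. `u = w = 0` on the left) and the exit vertex `t = z` differs
from it, so the row-`(0,0)` letter `(1−δ_{s,e_ι}) ‖s‖₂² 𝒯_{1̲,1,1}(e_ι,s,0)` read by `wt_mul_blockAbar'_zero_zero_diag`
keeps the index `≥ 1` of its own event on the line `t → u` (the cell's diagonal audit of the weighted `N = 1` pieces
classifies slot `(0,0)` CLEAN on both sides; LEAD concur STATUS l.4260 (1)); no index is upgraded anywhere in this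
module, App. C.1 (C.2) is cited as the print LOCATOR of the same case, and no inequality between a print letter and a
row letter is asserted.  No numeral; d-generic; no cited hypothesis; nothing landed is modified.
-/
import Literature.Probability.FitznerVanDerHofstad2017.NobleWeightedN1XSpace
import Literature.Probability.FitznerVanDerHofstad2017.NobleWeightedLettersHn
import Literature.Probability.FitznerVanDerHofstad2017.NobleWeightedParallelogram
import HarnessLib

/-!
# App. C.1 Case a): the class-`0` one-side-trivial pieces `R_R(ι,0)`, `R_L(ι,0)` onto the letters `H^D_1`, `H_2(0)`

[FvdH17] = Fitzner–van der Hofstad, *Mean-field behavior for nearest-neighbor percolation in `d > 10`*,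
EJP 22 (2017) no. 43; the extended version arXiv:1506.07977v2 carries App. C "Additional details for the bounds
on the NoBLE coefficients", whose §C.1 Case a) (display (C.2), p. 79) treats the diagram of the weighted
`N = 1` coefficient in which the right triangle is trivial (`z = x`) and the left triangle is of class `a = 0`
(`u = w`): `Σ_{w,ι,x} ‖x‖₂² ℙ(0⇔w) 𝒯_{1̲,1,1}(e_ι, x−w, 0) ≤ H^D_1 Σ_{ι,x} 𝒯_{1̲,1,1}(e_ι,x,0) + H_2(0) Σ_x D_{1,1}(x)`,
"where we recall (5.8) for the definitions of `H^D_1` and `H_2(x)`" (`H_n(x)` is display (5.8), `H^D_n` display (5.9)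
of §5.2, p. 50); the mirrored diagram (`u = w = 0`, exit
class `0`) is bounded "in the same way" (p. 80).

## What this module proves (all statements kernel-checked; nothing is assumed)

With `𝐋 = Letters.perc d p` (every `d`, every `p`), `F(w) := (1−δ_{w,0}) ℙ_p(0⇔w)` and the App. C.1 letter
`G_ι(s) := Ā'^{ι,0,0}(0,0,s,s)` (`blockAbar'` of `NobleBlocksPrime`, row `(0,0)` from §6.1):
* `perc_kdc_mul_dbc_eq_D_one_one` — `(1−δ_{w,0}) ℙ_p(0⇔w) = D_{1,1}(w)` for every `w` (a double connection
  between distinct sites is the disjoint occurrence of two open paths of length `≥ 1`; both sides vanish at `0`);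
  hence `Σ_w ‖w‖₂² F(w) = H^D_1` (`letterHD 𝐋 1` of `NobleWeightedLettersHn`) and `Σ_w F(w) = Σ_w D_{1,1}(w)` —
  equalities, no loss;
* `wt_mul_blockAbar'_zero_zero_diag` — `‖s‖₂² G_ι(s) = (1−δ_{s,e_ι}) ‖s‖₂² 𝒯_{1̲,1,1}(e_ι,s,0)` (any letters), hence
  `Σ_ι Σ_s ‖s‖₂² G_ι(s) ≤ H_2(0)` (`letterH 𝐋 2 0`; the third member, `NobleWeightedLettersHn`);
* `perc_rawRPiece_zero_eq_letters` — **Case a), right side trivial**: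
  `R_R(ι,0) = H^D_1 · Σ_s G_ι(s) + (Σ_w D_{1,1}(w)) · Σ_s ‖s‖₂² G_ι(s)` (the convolution shape
  `NobleWeightedN1XSpace.perc_rawRPiece_zero_eq` + the orthogonal split
  `NobleWeightedParallelogram.tsum_tsum_wt_mul_mul_sub_of_even`, evenness of `F`), and summed over `ι`:
  `perc_sum_rawRPiece_zero_le` — `Σ_ι R_R(ι,0) ≤ H^D_1 · Σ_{ι,s} G_ι(s) + (Σ_w D_{1,1}(w)) · H_2(0)`;
* `perc_rawLPiece_zero_eq_letters`, `perc_sum_rawLPiece_zero_le` — **Case a) mirrored, left side trivial**: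
  `Σ_ι R_L(ι,0) ≤ H_2(0) · Σ_w D_{1,1}(w) + (Σ_{ι,t} G_ι(t)) · H^D_1` (the orthogonal split with the evenness on
  the second factor, `tsum_tsum_wt_mul_mul_sub_of_even_right`).

## Reading notes

(1) Binders: none (`d`, `p` arbitrary); every sum is an `ℝ≥0∞`-valued `tsum`, no summability is used.
(2) The partner of `H^D_1` is kept as the typed App. C.1 letter `Σ_s Ā'^{ι,0,0}(0,0,s,s)` (the certified primed
object); the printed Lemma 5.1 regroups it as `Σ_x B_{1,2}(x,0)` — that regrouping and every numerical value of
the letters are outside this module (no numeral occurs here).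
(3) Purely additive: no declaration of the imported modules is restated or modified.
-/

noncomputable section

namespace Literature.Probability.FitznerVanDerHofstad2017.NobleBlocks

open _root_.MeasureTheory Literature.Probability.LatticeModels Literature.Probability.Percolation
open Literature.Probability.FitznerVanDerHofstad2017.BlockSummation
open Literature.Barriers.CriticalPhenomena (euclidNorm)
open scoped BigOperators ENNReal

local notation "𝐞" => Literature.Probability.Percolation.stepVec

variable {d : ℕ}

section Letters00

variable (p : unitInterval)

/-- **`(1−δ_{w,0}) ℙ_p(0⇔w) = D_{1,1}(w)`**: for `w ≠ 0` a double connection `{0 ⇔ w}` is the disjoint occurrence of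
two open paths `0 ←1→ w` (`openConnGe_one_eq`); at `w = 0` both sides vanish (`D_{1,1}(0) = 0`).
[cite: FitznerVanDerHofstad2017, §4.2 (4.12) (arXiv:1506.07977v2 p. 35); App. C.1 Case a), (C.2) (p. 79)] -/
theorem perc_kdc_mul_dbc_eq_D_one_one (w : Site d) :
    kdc w 0 * (Letters.perc d p).dbc w = (Letters.perc d p).D (.ge 1) (.ge 1) w := by
  by_cases hw : w = 0
  · subst hw
    rw [kdc_self, zero_mul, perc_D_ge, diagDT_zero_of_ne p one_ne_zero]
  · rw [kdc_of_ne hw, one_mul, perc_dbc, perc_D_ge, diagDT, openConnGe_one_eq (Ne.symm hw)]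

/-- **`Σ_w ‖w‖₂² (1−δ_{w,0}) ℙ_p(0⇔w) = H^D_1`** (`letterHD 𝐋 1 = Σ_x ‖x‖₂² D_{1,1}(x)`, display (5.9) (HD-def)).
[cite: FitznerVanDerHofstad2017, §5.2 (5.9) (HD-def) (arXiv:1506.07977v2 p. 50); App. C.1 Case a), (C.2) (p. 79)] -/
theorem perc_tsum_wt_mul_kdc_mul_dbc_eq_letterHD_one :
    ∑' w, wt w * (kdc w 0 * (Letters.perc d p).dbc w) = letterHD (Letters.perc d p) 1 := by
  unfold letterHD
  exact tsum_congr fun w => by rw [perc_kdc_mul_dbc_eq_D_one_one]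

/-- **`Σ_w (1−δ_{w,0}) ℙ_p(0⇔w) = Σ_w D_{1,1}(w)`**. [cite: FitznerVanDerHofstad2017, App. C.1 Case a), (C.2) (arXiv:1506.07977v2 p. 79); §4.2 (4.12) (p. 35)] -/
theorem perc_tsum_kdc_mul_dbc_eq_tsum_D_one_one :
    ∑' w, kdc w 0 * (Letters.perc d p).dbc w = ∑' w, (Letters.perc d p).D (.ge 1) (.ge 1) w :=
  tsum_congr fun w => perc_kdc_mul_dbc_eq_D_one_one p w

end Letters00

section LetterG

/-- The weighted diagonal of the App. C.1 letter: `‖s‖₂² Ā'^{ι,0,0}(0,0,s,s) = (1−δ_{s,e_ι}) ‖s‖₂² 𝒯_{1̲,1,1}(e_ι,s,0)`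
(row `(0,0)` of §6.1; the factor `1−δ_{0,s}` of the table dies on `‖0‖₂² = 0`), for any letter bundle.
[cite: FitznerVanDerHofstad2017, §6.1 (Bound-Xi-case-abZero) (arXiv:1506.07977v2 p. 59); App. C.1 (p. 79)] -/
theorem wt_mul_blockAbar'_zero_zero_diag (L : Letters d) (ι : Fin d × Bool) (s : Site d) :
    wt s * blockAbar' L ι 0 0 0 0 s s = kdc s (𝐞 ι) * wt s * L.T (.eq 1) (.ge 1) (.ge 1) (𝐞 ι) s 0 := by
  rw [blockAbar', ofBase_zero, blockAbar₀'_zero_zero]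
  by_cases hs : s = 0
  · subst hs; simp
  · rw [kd_self, kd_self, kdc_of_ne (Ne.symm hs)]; ring

variable (p : unitInterval)

/-- **`Σ_ι Σ_s ‖s‖₂² Ā'^{ι,0,0}_p(0,0,s,s) ≤ H_2(0)`** (the third member of `H_2(0)`, display (5.8) (Hi-defs);
`NobleWeightedLettersHn.tsum_sum_kdc_wt_perc_T_le_letterH_two_zero` after exchanging the two sums).
[cite: FitznerVanDerHofstad2017, §5.2 (5.8) (Hi-defs) (arXiv:1506.07977v2 p. 50); App. C.1 Case a), (C.2) (p. 79)] -/
theorem perc_sum_tsum_wt_mul_blockAbar'_zero_zero_diag_le_letterH_two_zero :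
    ∑ ι : Fin d × Bool, ∑' s, wt s * blockAbar' (Letters.perc d p) ι 0 0 0 0 s s ≤ letterH (Letters.perc d p) 2 0 := by
  calc ∑ ι : Fin d × Bool, ∑' s, wt s * blockAbar' (Letters.perc d p) ι 0 0 0 0 s s
      = ∑ ι : Fin d × Bool, ∑' s, kdc s (𝐞 ι) * wt s * (Letters.perc d p).T (.eq 1) (.ge 1) (.ge 1) (𝐞 ι) s 0 :=
        Finset.sum_congr rfl fun ι _ => tsum_congr fun s => wt_mul_blockAbar'_zero_zero_diag _ ι s
    _ = ∑' s, ∑ ι : Fin d × Bool, kdc s (𝐞 ι) * wt s * (Letters.perc d p).T (.eq 1) (.ge 1) (.ge 1) (𝐞 ι) s 0 :=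
        (Summable.tsum_finsetSum fun ι _ => ENNReal.summable).symm
    _ ≤ letterH (Letters.perc d p) 2 0 := tsum_sum_kdc_wt_perc_T_le_letterH_two_zero p

end LetterG

section CaseA

variable (p : unitInterval)

/-- **Case a), right side trivial, onto the letters**:
`R_R(ι,0) = H^D_1 · Σ_s Ā'^{ι,0,0}(0,0,s,s) + (Σ_w D_{1,1}(w)) · Σ_s ‖s‖₂² Ā'^{ι,0,0}(0,0,s,s)` — the convolution
shape of `R_R(ι,0)` split orthogonally (`‖x‖₂² = ‖w‖₂² + ‖x−w‖₂² + 2⟨w,x−w⟩`, the cross term killed by the evenness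
of `(1−δ_{w,0}) ℙ_p(0⇔w)`), then the two `F`-sums identified with `H^D_1` and `Σ D_{1,1}` (equalities).
[cite: FitznerVanDerHofstad2017, App. C.1 Case a), display (C.2) (arXiv:1506.07977v2 p. 79); §5.2 (5.8)–(5.9) (p. 50)] -/
theorem perc_rawRPiece_zero_eq_letters (ι : Fin d × Bool) :
    rawRPiece (blockPSn (Letters.perc d p)) (blockAbar' (Letters.perc d p)) ι 0 =
      letterHD (Letters.perc d p) 1 * (∑' s, blockAbar' (Letters.perc d p) ι 0 0 0 0 s s) +
        (∑' w, (Letters.perc d p).D (.ge 1) (.ge 1) w) *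
          (∑' s, wt s * blockAbar' (Letters.perc d p) ι 0 0 0 0 s s) := by
  rw [perc_rawRPiece_zero_eq, ← perc_tsum_wt_mul_kdc_mul_dbc_eq_letterHD_one p,
    ← perc_tsum_kdc_mul_dbc_eq_tsum_D_one_one p]
  exact tsum_tsum_wt_mul_mul_sub_of_even (fun w => kdc w 0 * (Letters.perc d p).dbc w)
    (fun s => blockAbar' (Letters.perc d p) ι 0 0 0 0 s s) (perc_kdc_mul_dbc_neg p)

/-- **Case a), right side trivial, summed over the direction `ι`**:
`Σ_ι R_R(ι,0) ≤ H^D_1 · Σ_{ι,s} Ā'^{ι,0,0}(0,0,s,s) + (Σ_w D_{1,1}(w)) · H_2(0)` — display (C.2) with its right-hand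
letters `H^D_1`, `H_2(0)` of (5.8) (the partner of `H^D_1` kept as the typed App. C.1 letter).
[cite: FitznerVanDerHofstad2017, App. C.1 Case a), display (C.2) (arXiv:1506.07977v2 p. 79); §5.2 Lemma 5.1, (5.8)–(5.9) (p. 50)] -/
theorem perc_sum_rawRPiece_zero_le :
    ∑ ι : Fin d × Bool, rawRPiece (blockPSn (Letters.perc d p)) (blockAbar' (Letters.perc d p)) ι 0 ≤
      letterHD (Letters.perc d p) 1 * (∑ ι : Fin d × Bool, ∑' s, blockAbar' (Letters.perc d p) ι 0 0 0 0 s s) +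
        (∑' w, (Letters.perc d p).D (.ge 1) (.ge 1) w) * letterH (Letters.perc d p) 2 0 := by
  calc ∑ ι : Fin d × Bool, rawRPiece (blockPSn (Letters.perc d p)) (blockAbar' (Letters.perc d p)) ι 0
      = ∑ ι : Fin d × Bool, (letterHD (Letters.perc d p) 1 * (∑' s, blockAbar' (Letters.perc d p) ι 0 0 0 0 s s) +
          (∑' w, (Letters.perc d p).D (.ge 1) (.ge 1) w) *
            (∑' s, wt s * blockAbar' (Letters.perc d p) ι 0 0 0 0 s s)) :=
        Finset.sum_congr rfl fun ι _ => perc_rawRPiece_zero_eq_letters p ι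
    _ = letterHD (Letters.perc d p) 1 * (∑ ι : Fin d × Bool, ∑' s, blockAbar' (Letters.perc d p) ι 0 0 0 0 s s) +
          (∑' w, (Letters.perc d p).D (.ge 1) (.ge 1) w) *
            (∑ ι : Fin d × Bool, ∑' s, wt s * blockAbar' (Letters.perc d p) ι 0 0 0 0 s s) := by
        rw [Finset.sum_add_distrib, Finset.mul_sum, Finset.mul_sum]
    _ ≤ _ := by
        gcongr
        exact perc_sum_tsum_wt_mul_blockAbar'_zero_zero_diag_le_letterH_two_zero p

/-- **Case a) mirrored, left side trivial, onto the letters**: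
`R_L(ι,0) = (Σ_t ‖t‖₂² Ā'^{ι,0,0}(0,0,t,t)) · Σ_w D_{1,1}(w) + (Σ_t Ā'^{ι,0,0}(0,0,t,t)) · H^D_1` — the orthogonal
split with the evenness on the second (shifted) factor `(1−δ_{·,0}) ℙ_p(0⇔·)`.
[cite: FitznerVanDerHofstad2017, App. C.1 Case a) mirrored, "the diagram in which u = w = 0 … in the same way" (arXiv:1506.07977v2 pp. 79–80); §5.2 (5.8)–(5.9) (p. 50)] -/
theorem perc_rawLPiece_zero_eq_letters (ι : Fin d × Bool) :
    rawLPiece (blockAbar' (Letters.perc d p)) (blockPEn (Letters.perc d p)) ι 0 =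
      (∑' t, wt t * blockAbar' (Letters.perc d p) ι 0 0 0 0 t t) * (∑' w, (Letters.perc d p).D (.ge 1) (.ge 1) w) +
        (∑' t, blockAbar' (Letters.perc d p) ι 0 0 0 0 t t) * letterHD (Letters.perc d p) 1 := by
  rw [perc_rawLPiece_zero_eq, ← perc_tsum_wt_mul_kdc_mul_dbc_eq_letterHD_one p,
    ← perc_tsum_kdc_mul_dbc_eq_tsum_D_one_one p]
  exact tsum_tsum_wt_mul_mul_sub_of_even_right (fun t => blockAbar' (Letters.perc d p) ι 0 0 0 0 t t)
    (fun w => kdc w 0 * (Letters.perc d p).dbc w) (perc_kdc_mul_dbc_neg p)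

/-- **Case a) mirrored, summed over the direction `ι`**:
`Σ_ι R_L(ι,0) ≤ H_2(0) · Σ_w D_{1,1}(w) + (Σ_{ι,t} Ā'^{ι,0,0}(0,0,t,t)) · H^D_1`.
[cite: FitznerVanDerHofstad2017, App. C.1 Case a) mirrored (arXiv:1506.07977v2 pp. 79–80); §5.2 Lemma 5.1, (5.8)–(5.9) (p. 50)] -/
theorem perc_sum_rawLPiece_zero_le :
    ∑ ι : Fin d × Bool, rawLPiece (blockAbar' (Letters.perc d p)) (blockPEn (Letters.perc d p)) ι 0 ≤
      letterH (Letters.perc d p) 2 0 * (∑' w, (Letters.perc d p).D (.ge 1) (.ge 1) w) +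
        (∑ ι : Fin d × Bool, ∑' t, blockAbar' (Letters.perc d p) ι 0 0 0 0 t t) * letterHD (Letters.perc d p) 1 := by
  calc ∑ ι : Fin d × Bool, rawLPiece (blockAbar' (Letters.perc d p)) (blockPEn (Letters.perc d p)) ι 0
      = ∑ ι : Fin d × Bool, ((∑' t, wt t * blockAbar' (Letters.perc d p) ι 0 0 0 0 t t) *
            (∑' w, (Letters.perc d p).D (.ge 1) (.ge 1) w) +
          (∑' t, blockAbar' (Letters.perc d p) ι 0 0 0 0 t t) * letterHD (Letters.perc d p) 1) :=
        Finset.sum_congr rfl fun ι _ => perc_rawLPiece_zero_eq_letters p ι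
    _ = (∑ ι : Fin d × Bool, ∑' t, wt t * blockAbar' (Letters.perc d p) ι 0 0 0 0 t t) *
            (∑' w, (Letters.perc d p).D (.ge 1) (.ge 1) w) +
          (∑ ι : Fin d × Bool, ∑' t, blockAbar' (Letters.perc d p) ι 0 0 0 0 t t) * letterHD (Letters.perc d p) 1 := by
        rw [Finset.sum_add_distrib, Finset.sum_mul, Finset.sum_mul]
    _ ≤ _ := by
        gcongr
        exact perc_sum_tsum_wt_mul_blockAbar'_zero_zero_diag_le_letterH_two_zero p

end CaseA

end Literature.Probability.FitznerVanDerHofstad2017.NobleBlocks
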